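import Literature.NumberTheory.NumberFields.EquivariantIwasawaLemmaRamification
import Literature.NumberTheory.EllipticCurves.IwasawaTowerTorsionOrdinaryProofs
import HarnessLib

/-!
# The equivariant Iwasawa lemma, VII: the orbit input from one totally ramified prime — door L6
# for `L₀K_n` as a theorem

Topic `NumberTheory/NumberFields` (namespace = path, grouping sub-namespace `EquivariantIwasawaLemma`).
THEOREM-ONLY file (no definition, no named fact, no `sorry`), written by the literature seat
`bsd-potss-conjA-anchor` g16 (cell `bsd-potss`; serves stmt-BirchSwinnertonDyer-19386 / 19413; closes
nothing; neither Conjecture A nor BSD is proved for any curve here).  Sequel of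
`EquivariantIwasawaLemmaRamification.lean`: its remaining input (orbit)ₙ — an inertia element `σ` of a
prime `𝔓̄` of `ℤ̄_k` with `σ|_{L₀} = 1`, `σ ∈ κ⁻¹(pⁿℤ_p) ∖ κ⁻¹(pⁿ⁺¹ℤ_p)`, and `p ∤` the number of
`Gal(L₀K_{n+1}/k)`-conjugates of `𝔓̄ ∩ L₀K_{n+1}` — is DISCHARGED from «one prime `𝔓̄` of `ℤ̄_k` is
totally ramified in `K_∞/k`», i.e. `I_𝔓̄ · Gal(k̄/K_∞) = Γ_k` (`𝔓̄.inertia Γ_k ⊔ κ.kerSubgroup = ⊤`, the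
tree's `TotallyRamifiedFrom κ 0` disjunct; for the cyclotomic `ℤ_p`-extension of `ℚ` and `𝔓̄ ∣ p` this is
the tree's `ZpExtension.IsCyclotomic.inertia_sup_kerSubgroup_eq_top`), together with `p ∤ [L₀ : k]`:
pick `i ∈ I_𝔓̄` with `κ(i) = 1`; then `σ = i^{m pⁿ}` (`m = [L₀:k]`) works, and every element of
`Gal(L₀K_{n+1}/L₀)` is the restriction of some `i^{m t}`, so `Gal(L₀K_{n+1}/L₀) ≤ I(𝔓̄ ∩ L₀K_{n+1}) ≤
Stab(𝔓̄ ∩ L₀K_{n+1})` and the number of conjugates divides `[L₀ : k]`.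

* **`equivariantHom_classGroup_eq_zero_layer_compositum_tower_of_totallyRamified`** — DOOR L6: `k` a
  number field, `p` odd, `κ` a `ℤ_p`-extension of `k` with layers `K_n`, `L₀ ⊆ k̄` finite Galois over `k`
  with `p ∤ [L₀ : k]`, one prime of `ℤ̄_k` totally ramified in `K_∞/k`; `V` a `p`-torsion `Γ_k`-module on
  which `Γ_{L₀}` acts trivially with (c2*) `Hom_{Γ_k}(Cl(L₀), V) = 0` and (c3*) `V^{D_v} = 0` for every
  `v ∣ p` ⟹ `Hom_{Γ_k}(Cl(L₀K_n), V) = 0` for every `n`.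
* `exists_isMaximal_inertia_sup_kerSubgroup_eq_top_of_isCyclotomic` — the totally ramified prime for
  `k = ℚ`, `κ` cyclotomic (tree `IsCyclotomic.inertia_sup_kerSubgroup_eq_top`), i.e. the input `hram` of the
  previous theorem; for `L₀ = ℚ(E[p])`, `V = E[p]` that theorem is door L6 of the cell's census
  («`p ∤ #Gal(ℚ(E[p])/ℚ)`, `E[p]`-part of `Cl(ℚ(E[p]))` trivial, `E(ℚ_p)[p] = 0` ⟹ the `E[p]`-part of
  `Cl(ℚ_n(E[p]))` is trivial for all `n`»).  (No `k = ℚ` restatement is given: binders `[IsGalois ℚ L₀]`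
  written at `k = ℚ` pick Mathlib's `algebraRat` and do not match `absRestrictNormalHom`'s algebra
  instance syntactically; consumers instantiate the general theorem at `k := ℚ` in their own context.)

## References

* L. C. Washington, *Introduction to Cyclotomic Fields*, 2nd ed., GTM 83 (1997), §13.1, Prop. 13.2,
  §13.3 Lemmas 13.14–13.15, Thm. 10.4. [Washington1997]
* J. Neukirch, *Algebraic Number Theory* (1999), Ch. I §9 (9.1); Ch. II (9.6); Ch. VI (6.9), (7.1);
  Ch. IV §6. [NeukirchANT1999]
* J.-P. Serre, *Local Fields*, GTM 67 (1979), Ch. I §7 Prop. 22. [SerreLocalFields1979]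
-/

noncomputable section

open scoped Pointwise nonZeroDivisors
open NumberField Field IntermediateField Ideal IsDedekindDomain
open Literature.NumberTheory.GaloisRepresentations
open Literature.NumberTheory.EllipticCurves (ringOfIntegersToIntegralClosure
  coe_ringOfIntegersToIntegralClosure ringOfIntegersToIntegralClosure_comp_algebraMap
  ringOfIntegersToIntegralClosure_injective ZpExtension)

namespace Literature.NumberTheory.NumberFields

namespace EquivariantIwasawaLemma

section TotallyRamified

variable {k : Type} [Field k]

/-- `τ|_E = 1` iff `τ ∈ Gal(k̄/E)`. [folklore] -/
private theorem absRestrictNormalHom_eq_one_iff_mem_fixingSubgroup''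
    (E : IntermediateField k (AlgebraicClosure k)) [Normal k E] (τ : absoluteGaloisGroup k) :
    absRestrictNormalHom E τ = 1 ↔ absoluteGaloisGroup.toAlgEquiv k τ ∈ E.fixingSubgroup := by
  have hc : ∀ x : E, ((absRestrictNormalHom E τ x : E) : AlgebraicClosure k) =
      τ • (x : AlgebraicClosure k) := fun x => AlgEquiv.restrictNormalHom_apply E _ x
  rw [IntermediateField.mem_fixingSubgroup_iff]
  constructor
  · intro h x hx
    change τ • x = x
    rw [← hc ⟨x, hx⟩, h, AlgEquiv.one_apply]
  · intro h
    ext x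
    rw [hc x, AlgEquiv.one_apply]
    exact h x x.2

/-- `τ|_{E₁E₂} = 1 ↔ τ|_{E₁} = 1 ∧ τ|_{E₂} = 1`. [folklore] -/
private theorem absRestrictNormalHom_sup_eq_one_iff' (E₁ E₂ : IntermediateField k (AlgebraicClosure k))
    [Normal k E₁] [Normal k E₂] (τ : absoluteGaloisGroup k) :
    absRestrictNormalHom (E₁ ⊔ E₂ : IntermediateField k (AlgebraicClosure k)) τ = 1 ↔
      absRestrictNormalHom E₁ τ = 1 ∧ absRestrictNormalHom E₂ τ = 1 := by
  rw [absRestrictNormalHom_eq_one_iff_mem_fixingSubgroup'',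
    absRestrictNormalHom_eq_one_iff_mem_fixingSubgroup'',
    absRestrictNormalHom_eq_one_iff_mem_fixingSubgroup'', IntermediateField.fixingSubgroup_sup,
    Subgroup.mem_inf]

variable {p : ℕ} [Fact p.Prime]

/-- From `I_𝔓̄ · Gal(k̄/K_∞) = Γ_k`: an inertia element `i` with `κ(i) = 1`. [folklore] -/
private theorem exists_mem_inertia_toAdd_eq_one (κ : ZpExtension k p)
    {𝔓' : Ideal (absIntegers (𝓞 k) k)}
    (h : 𝔓'.inertia (absoluteGaloisGroup k) ⊔ κ.kerSubgroup = ⊤) :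
    ∃ i ∈ 𝔓'.inertia (absoluteGaloisGroup k), (κ i).toAdd = 1 := by
  obtain ⟨γ, hγ⟩ := κ.surjective (Multiplicative.ofAdd 1)
  rw [ZpExtension.coe_toContinuousMonoidHom] at hγ
  haveI : κ.kerSubgroup.Normal := by
    change (κ.toContinuousMonoidHom.toMonoidHom.ker).Normal
    infer_instance
  have hγmem : γ ∈ ((𝔓'.inertia (absoluteGaloisGroup k) ⊔ κ.kerSubgroup :
      Subgroup (absoluteGaloisGroup k)) : Set (absoluteGaloisGroup k)) := by
    rw [h]; trivial
  rw [Subgroup.mul_normal] at hγmem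
  obtain ⟨i, hi, n, hn, rfl⟩ := Set.mem_mul.mp hγmem
  refine ⟨i, hi, ?_⟩
  have hn1 : κ n = 1 := ZpExtension.mem_kerSubgroup.mp hn
  rw [map_mul, hn1, mul_one] at hγ
  rw [hγ]
  rfl

/-- `(p : ℤ_p) ∣ (m : ℤ_p) → p ∣ m` for natural `m`. [folklore] -/
private theorem natCast_dvd_of_padicInt_dvd {m : ℕ} (h : (p : ℤ_[p]) ∣ (m : ℤ_[p])) : p ∣ m := by
  have h1 : ‖((m : ℤ) : ℤ_[p])‖ < 1 := by
    rw [Int.cast_natCast]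
    exact (PadicInt.norm_lt_one_iff_dvd _).mpr h
  have h2 := (PadicInt.norm_int_lt_one_iff_dvd (m : ℤ)).mp h1
  exact_mod_cast h2

variable [NumberField k]

/-- `g|_{K_m} = 1 ↔ g ∈ κ⁻¹(pᵐℤ_p)`. [folklore] -/
private theorem absRestrictNormalHom_layer_eq_one_iff'' (κ : ZpExtension k p)
    (m : ℕ) [Normal k (κ.layer m)] (g : absoluteGaloisGroup k) :
    absRestrictNormalHom (κ.layer m) g = 1 ↔ g ∈ κ.layerSubgroup m := by
  rw [absRestrictNormalHom_eq_one_iff_mem_fixingSubgroup'', κ.fixingSubgroup_layer m]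
  constructor
  · rintro ⟨g', hg', hgg'⟩
    have : g' = g := (absoluteGaloisGroup.toAlgEquiv k).injective hgg'
    exact this ▸ hg'
  · exact fun h => ⟨g, h, rfl⟩

/-- Restriction `Γ_k → Gal(E/k)` is onto. [folklore] -/
private theorem absRestrictNormalHom_surjective'' (E : IntermediateField k (AlgebraicClosure k))
    [Normal k E] : Function.Surjective (absRestrictNormalHom E) := fun g => by
  obtain ⟨σ, hσ⟩ := AlgEquiv.restrictNormalHom_surjective (AlgebraicClosure k) g
  exact ⟨(Field.absoluteGaloisGroup.toAlgEquiv k).symm σ, hσ⟩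

set_option maxHeartbeats 1600000 in
set_option synthInstance.maxHeartbeats 200000 in
/-- **The orbit input from a totally ramified prime.**  `κ` a `ℤ_p`-extension of the number field `k`,
`𝔓̄` a maximal ideal of `ℤ̄_k` with `I_𝔓̄ · Gal(k̄/K_∞) = Γ_k`, `L₀ ⊆ k̄` finite Galois with
`p ∤ m = [L₀ : k]`, `n : ℕ`, `F = L₀K_{n+1}`.  Then for `i ∈ I_𝔓̄` with `κ(i) = 1`: `σ = i^{m pⁿ} ∈ I_𝔓̄` has
`σ|_{L₀} = 1`, `κ(σ) = m pⁿ ∈ pⁿℤ_p ∖ pⁿ⁺¹ℤ_p`; and `Gal(F/L₀) ≤ I(𝔓̄ ∩ F)` (every `τ` with `τ|_{L₀} = 1`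
agrees on `F` with `i^{m t}` for `m t ≡ κ(τ) (mod pⁿ⁺¹)`), so `Stab(𝔓̄ ∩ F) ⊇ Gal(F/L₀)` and the number of
conjugates of `𝔓̄ ∩ F` divides `[L₀ : k]`. [cite: Washington1997, §13.1 and §13.3 (proof of Lemma 13.15)]
[cite: SerreLocalFields1979, Ch. I §7 Prop. 22(b)] -/
theorem exists_orbit_input_of_totallyRamified (κ : ZpExtension k p)
    (L₀ : IntermediateField k (AlgebraicClosure k)) [FiniteDimensional k L₀] [IsGalois k L₀]
    (hL₀ : ¬ p ∣ Module.finrank k L₀)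
    [∀ n, FiniteDimensional k (κ.layer n)] [∀ n, IsGalois k (κ.layer n)]
    {𝔓' : Ideal (absIntegers (𝓞 k) k)} [𝔓'.IsMaximal]
    (hram : 𝔓'.inertia (absoluteGaloisGroup k) ⊔ κ.kerSubgroup = ⊤) (n : ℕ) :
    ∃ σ : absoluteGaloisGroup k, σ ∈ 𝔓'.inertia (absoluteGaloisGroup k) ∧
      absRestrictNormalHom L₀ σ = 1 ∧ σ ∈ κ.layerSubgroup n ∧ σ ∉ κ.layerSubgroup (n + 1) ∧
      ¬ p ∣ (MulAction.stabilizer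
        ((L₀ ⊔ κ.layer (n + 1) : IntermediateField k (AlgebraicClosure k)) ≃ₐ[k]
          (L₀ ⊔ κ.layer (n + 1) : IntermediateField k (AlgebraicClosure k)))
        (𝔓'.comap (ringOfIntegersToIntegralClosure (k := k) (Ω := AlgebraicClosure k)
          (L₀ ⊔ κ.layer (n + 1) : IntermediateField k (AlgebraicClosure k))))).index := by
  classical
  have hp : p.Prime := Fact.out
  have hp0 : (p : ℤ_[p]) ≠ 0 := by exact_mod_cast hp.ne_zero
  haveI hKn : ∀ m, Normal k (κ.layer m) := fun m => inferInstance
  set m := Module.finrank k L₀ with hmdef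
  have hcard : Nat.card (L₀ ≃ₐ[k] L₀) = m := IsGalois.card_aut_eq_finrank k L₀
  obtain ⟨i, hiI, hi1⟩ := exists_mem_inertia_toAdd_eq_one κ hram
  -- powers of `i`
  have hiL₀ : ∀ t : ℕ, absRestrictNormalHom L₀ (i ^ (m * t)) = 1 := by
    intro t
    rw [map_pow, pow_mul, ← hcard, pow_card_eq_one', one_pow]
  have hκpow : ∀ N : ℕ, (κ (i ^ N)).toAdd = (N : ℤ_[p]) := by
    intro N
    rw [map_pow, toAdd_pow, hi1, nsmul_eq_mul, mul_one]
  -- ### the field `F = L₀ K_{n+1}`, the prime `𝔓₀ = 𝔓̄ ∩ F`, `Gal(F/L₀) ≤ I(𝔓₀) ≤ Stab(𝔓₀)`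
  set F : IntermediateField k (AlgebraicClosure k) := L₀ ⊔ κ.layer (n + 1) with hFdef
  have hIF : (𝔓'.comap (ringOfIntegersToIntegralClosure (k := k) (Ω := AlgebraicClosure k) F)).inertia
      (F ≃ₐ[k] F) = (𝔓'.inertia (absoluteGaloisGroup k)).map (absRestrictNormalHom F) :=
    inertia_comap_ringOfIntegers_eq_map_absRestrictNormalHom F 𝔓'
  have hL₀F : L₀ ≤ F := le_sup_left
  set L₀i : IntermediateField k F := IntermediateField.restrict hL₀F with hL₀idef
  have hNI : L₀i.fixingSubgroup ≤
      (𝔓'.comap (ringOfIntegersToIntegralClosure (k := k) (Ω := AlgebraicClosure k) F)).inertia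
        (F ≃ₐ[k] F) := by
    intro g hg
    obtain ⟨τ, rfl⟩ := absRestrictNormalHom_surjective'' F g
    -- `τ|_{L₀} = 1`
    have hτL₀ : absRestrictNormalHom L₀ τ = 1 := by
      rw [absRestrictNormalHom_eq_one_iff_mem_fixingSubgroup'', IntermediateField.mem_fixingSubgroup_iff]
      intro y hy
      have hy' : (⟨y, hL₀F hy⟩ : F) ∈ L₀i := (mem_restrict hL₀F _).2 hy
      have h1 := (IntermediateField.mem_fixingSubgroup_iff _ _).mp hg _ hy'
      have h2 := congrArg (fun z : F => (z : AlgebraicClosure k)) h1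
      exact (AlgEquiv.restrictNormalHom_apply F _ ⟨y, hL₀F hy⟩).symm.trans h2
    -- solve `m t ≡ κ τ (mod p^{n+1})`
    set a : ℤ_[p] := (κ τ).toAdd with hadef
    set a₀ : ℕ := PadicInt.appr a (n + 1) with ha₀def
    have ha₀ : (p : ℤ_[p]) ^ (n + 1) ∣ a - a₀ :=
      Ideal.mem_span_singleton.mp (PadicInt.appr_spec (n + 1) a)
    have hcop : Nat.Coprime m (p ^ (n + 1)) :=
      (Nat.coprime_comm.mp (hp.coprime_iff_not_dvd.mpr hL₀)).pow_right _
    obtain ⟨t, -, ht⟩ := Nat.exists_mul_mod_eq_of_coprime a₀ hcop (pow_ne_zero _ hp.ne_zero)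
    have hmt : (p : ℤ_[p]) ^ (n + 1) ∣ (a₀ : ℤ_[p]) - ((m * t : ℕ) : ℤ_[p]) := by
      have h1 := map_dvd (Int.castRingHom ℤ_[p]) (Nat.modEq_iff_dvd.mp ht)
      push_cast at h1
      exact_mod_cast h1
    -- `τ|_F = (i^{m t})|_F`
    have hτi : absRestrictNormalHom F ((i ^ (m * t))⁻¹ * τ) = 1 := by
      change absRestrictNormalHom (L₀ ⊔ κ.layer (n + 1) : IntermediateField k (AlgebraicClosure k))
        ((i ^ (m * t))⁻¹ * τ) = 1
      rw [absRestrictNormalHom_sup_eq_one_iff']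
      constructor
      · rw [map_mul, map_inv, hiL₀ t, inv_one, one_mul]
        exact hτL₀
      · rw [absRestrictNormalHom_layer_eq_one_iff'', ZpExtension.mem_layerSubgroup, map_mul, map_inv,
          toAdd_mul, toAdd_inv, hκpow]
        have e : -((m * t : ℕ) : ℤ_[p]) + a = (a - a₀) + ((a₀ : ℤ_[p]) - ((m * t : ℕ) : ℤ_[p])) := by
          ring
        rw [e]
        exact dvd_add ha₀ hmt
    rw [map_mul, map_inv, inv_mul_eq_one] at hτi
    rw [hIF, ← hτi]
    exact Subgroup.mem_map_of_mem _ (Subgroup.pow_mem _ hiI _)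
  have hIS := Ideal.inertia_le_stabilizer (M := F ≃ₐ[k] F)
    (𝔓'.comap (ringOfIntegersToIntegralClosure (k := k) (Ω := AlgebraicClosure k) F))
  -- the index of the stabiliser divides `[L₀ : k]`
  have hidx : (L₀i.fixingSubgroup).index = m := by
    have h3 := L₀i.fixingSubgroup.index_mul_card
    rw [IsGalois.card_fixingSubgroup_eq_finrank L₀i, IsGalois.card_aut_eq_finrank k F,
      ← Module.finrank_mul_finrank k L₀i F] at h3
    have h4 : Module.finrank k L₀i = m :=
      ((IntermediateField.restrict_algEquiv hL₀F).toLinearEquiv.finrank_eq).symm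
    exact (mul_right_cancel₀ (Module.finrank_pos (R := L₀i) (M := F)).ne' h3).trans h4
  have hdvd : (MulAction.stabilizer (F ≃ₐ[k] F)
      (𝔓'.comap (ringOfIntegersToIntegralClosure (k := k) (Ω := AlgebraicClosure k) F))).index ∣ m := by
    rw [← hidx]
    exact Subgroup.index_dvd_of_le (hNI.trans hIS)
  -- ### the element `σ = i^{m pⁿ}`
  refine ⟨i ^ (m * p ^ n), Subgroup.pow_mem _ hiI _, hiL₀ (p ^ n), ?_, ?_,
    fun h => hL₀ (dvd_trans h hdvd)⟩
  · rw [ZpExtension.mem_layerSubgroup, hκpow]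
    push_cast
    exact dvd_mul_left _ _
  · intro h
    rw [ZpExtension.mem_layerSubgroup, hκpow] at h
    push_cast at h
    apply hL₀
    apply natCast_dvd_of_padicInt_dvd
    rw [pow_succ, mul_comm (m : ℤ_[p])] at h
    exact (mul_dvd_mul_iff_left (pow_ne_zero n hp0)).mp h

set_option maxHeartbeats 1600000 in
set_option synthInstance.maxHeartbeats 200000 in
/-- **Door L6: the equivariant Iwasawa lemma along `L₀K_n` for a `ℤ_p`-extension with a totally ramified
prime.**  `k` a number field, `p` an odd prime, `κ` a `ℤ_p`-extension of `k` with layers `K_n = κ.layer n`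
(finite Galois over `k`), `L₀ ⊆ k̄` finite Galois over `k` with `p ∤ [L₀ : k]`, and a maximal ideal `𝔓̄` of
`ℤ̄_k` totally ramified in `K_∞/k`: `I_𝔓̄ · Gal(k̄/K_∞) = Γ_k`.  `V` a `p`-torsion `Γ_k`-module on which
`Γ_{L₀}` acts trivially, with (c2*) every additive `Γ_k`-equivariant `Cl(𝓞_{L₀}) → V` zero and (c3*)
`V^{D_v} = 0` for every finite place `v ∣ p` of `k` (`D_v = GreenbergSelmer.decomp v`).  Then for every `n`
every additive `Γ_k`-equivariant `Cl(𝓞_{L₀K_n}) → V` is zero: `equivariantHom_classGroup_eq_zero_layer_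
compositum_tower` with its orbit input supplied by `exists_orbit_input_of_totallyRamified`.
[cite: Washington1997, §13.1 Prop. 13.2, §13.3 Lemmas 13.14–13.15 and Thm. 10.4 (proof)]
[cite: NeukirchANT1999, Ch. I §9 (9.1), Ch. II §9 (9.6), Ch. VI (6.9), (7.1) and Ch. IV §6] -/
theorem equivariantHom_classGroup_eq_zero_layer_compositum_tower_of_totallyRamified
    (hp2 : p ≠ 2) (κ : ZpExtension k p)
    (L₀ : IntermediateField k (AlgebraicClosure k)) [FiniteDimensional k L₀] [IsGalois k L₀]
    (hL₀ : ¬ p ∣ Module.finrank k L₀)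
    [∀ n, FiniteDimensional k (κ.layer n)] [∀ n, IsGalois k (κ.layer n)]
    [∀ n, NumberField (L₀ ⊔ κ.layer n : IntermediateField k (AlgebraicClosure k))]
    (hram : ∃ 𝔓' : Ideal (absIntegers (𝓞 k) k), 𝔓'.IsMaximal ∧
      𝔓'.inertia (absoluteGaloisGroup k) ⊔ κ.kerSubgroup = ⊤)
    {V : Type*} [AddCommGroup V] [DistribMulAction (absoluteGaloisGroup k) V]
    (hpV : ∀ v : V, p • v = 0)
    (hV : ∀ τ : absoluteGaloisGroup k, absRestrictNormalHom L₀ τ = 1 → ∀ v : V, τ • v = v)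
    (h0 : ∀ μ : Additive (ClassGroup (𝓞 L₀)) →+ V,
      (∀ (τ : absoluteGaloisGroup k) (c : ClassGroup (𝓞 L₀)),
        μ (Additive.ofMul (ClassGroup.mulEquiv
          (AmbiguousClass.intAut (absRestrictNormalHom L₀ τ)) c)) = τ • μ (Additive.ofMul c)) →
      μ = 0)
    (hD : ∀ v : HeightOneSpectrum (𝓞 k), ((p : ℕ) : 𝓞 k) ∈ v.asIdeal →
      ∀ w : V, (∀ d ∈ EllipticCurves.GreenbergSelmer.decomp v, d • w = w) → w = 0)
    (n : ℕ)
    (f : Additive (ClassGroup (𝓞 (L₀ ⊔ κ.layer n : IntermediateField k (AlgebraicClosure k)))) →+ V)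
    (hf : ∀ (τ : absoluteGaloisGroup k)
        (c : ClassGroup (𝓞 (L₀ ⊔ κ.layer n : IntermediateField k (AlgebraicClosure k)))),
      f (Additive.ofMul (ClassGroup.mulEquiv (AmbiguousClass.intAut
        (absRestrictNormalHom (L₀ ⊔ κ.layer n : IntermediateField k (AlgebraicClosure k)) τ)) c)) =
        τ • f (Additive.ofMul c)) :
    f = 0 := by
  obtain ⟨𝔓', h𝔓'max, hsup⟩ := hram
  haveI := h𝔓'max
  refine equivariantHom_classGroup_eq_zero_layer_compositum_tower hp2 κ L₀ hL₀ hpV hV h0 hD ?_ n f hf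
  intro m
  obtain ⟨σ, hσI, h0σ, hn, hn1, hidx⟩ := exists_orbit_input_of_totallyRamified κ L₀ hL₀ hsup m
  exact ⟨𝔓', h𝔓'max, σ, hσI, h0σ, hn, hn1, hidx⟩

/-- **The totally ramified prime for the cyclotomic `ℤ_p`-extension of `ℚ`**: there is a maximal ideal `𝔓̄`
of `ℤ̄` (any prime above `p`) with `I_𝔓̄ · Gal(ℚ̄/ℚ_∞) = Γ_ℚ` — the input `hram` of
`equivariantHom_classGroup_eq_zero_layer_compositum_tower_of_totallyRamified` for `k = ℚ` (tree
`ZpExtension.IsCyclotomic.inertia_sup_kerSubgroup_eq_top`: `ℚ_∞/ℚ` is totally ramified at `p`).  With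
`L₀ = ℚ(E[p])`, `V = E[p]` for an elliptic curve `E/ℚ` with `p ∤ #Gal(ℚ(E[p])/ℚ)` that theorem then reads:
«`E[p]`-part of `Cl(ℚ(E[p]))` zero and `E(ℚ_p)[p] = 0` ⟹ `E[p]`-part of `Cl(ℚ_n(E[p]))` zero for all `n`»
(door L6 of the cell's census). [cite: Washington1997, §13.1 (ℚ_∞/ℚ totally ramified at p)] -/
theorem exists_isMaximal_inertia_sup_kerSubgroup_eq_top_of_isCyclotomic {κ : ZpExtension ℚ p}
    (hκ : κ.IsCyclotomic) :
    ∃ 𝔓' : Ideal (absIntegers (𝓞 ℚ) ℚ), 𝔓'.IsMaximal ∧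
      𝔓'.inertia (absoluteGaloisGroup ℚ) ⊔ κ.kerSubgroup = ⊤ := by
  have hp : p.Prime := Fact.out
  set v : HeightOneSpectrum (𝓞 ℚ) := (Rat.HeightOneSpectrum.primesEquiv (R := 𝓞 ℚ)).symm ⟨p, hp⟩
    with hvdef
  have hv : (Rat.HeightOneSpectrum.primesEquiv (R := 𝓞 ℚ) v : ℕ) = p := by
    rw [hvdef, Equiv.apply_symm_apply]
  obtain ⟨𝔓', h𝔓'⟩ := HeightOneSpectrum.primesAbove_nonempty v
  exact ⟨𝔓', HeightOneSpectrum.isMaximal_of_mem_primesAbove h𝔓', hκ.inertia_sup_kerSubgroup_eq_top hv h𝔓'⟩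

end TotallyRamified

end EquivariantIwasawaLemma

end Literature.NumberTheory.NumberFields

end
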